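import Summits.AnomalousDissipation.AnomalousDissipation.Theorems.SolenoidalFractalHomogenisationLagrangianStepCellClauseCuts
import Summits.AnomalousDissipation.AnomalousDissipation.Theorems.SolenoidalFractalHomogenisationLagrangianStepOneLevelGlueLower
import HarnessLib

/-!
# K1L `LagrangianRenormalisationStep(Design)` (stmt-AnomalousDissipation-24912 → K1L_D): SHARED DEFINITIONS of the ν-dependent shape FAMILY and of the
# S⋆-centred ORDER-INTERVAL window with centre defect (helper; `--supports … --as helper`; LANDING LIST F1, part a)

Summits-side definitions file of route `SolenoidalFractalHomogenisation` (objects the K1L line posits + their elementary algebra; no named facts, no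
sorry).  Landing item F1 (part a: §1 transverse Loewner order / order intervals / currency conversions, §2 `IntervalWindowClause`, §3 the family shape
sequence `shapeSeqF` / `chainTensorF` / running aspect `aspF` / `TailDefectBound`, §5 the package `IntervalWindowFamily`, and the `μ ≡ 1` discharges of
§7) of the tenure planner's LANDING MAP (cell `ad-ideate`, tenure D24-2 (c) / D24-3, STATUS 2026-08-28T13:04:46Z) for the crux workfile
`Cruxes/LagrangianRenormalisationStep/IntervalWindowFamilySketch.lean` (planner ad-ideate-p4 g9, lens «control», commit 78e41dd75007, farm rc 0),
texts copied VERBATIM into the shared namespace `…Theorems.SolenoidalFractalHomogenisation.LagrangianStep` (K1L SHARED-DEFS RULE: every decl in an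
open stub's signature is a landed tree decl; skeleton v2 of K1L_D imports Theorems files only).  Part b (`…OneLevelDefsSectorial`: §6–§7 sectorial odd
guard) and the consumer facts (F2 `…CellClauseCutsFamily`, F3 `…OneLevelGlueLowerFamily`) are sibling files.

WHAT IS TYPED.  Tenure D24-1 frees the one-level shape map of `stub_cellLawV` to a family `Φ : ℝ → (Visc4 → Visc4)` (level `i` renormalised through
`Φ (E.cellVisc i)`); the window that survives the family (finding F-p4g9-1: `renormStep` is radially of degree −1, so a COMMON-centre exact clause cannot
hold across the family) is the S⋆-centred order interval `[[S⋆/λ, λS⋆]]` (closed Thompson part-metric ball) mapped into the interval of aspect `μ_ν·λ`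
with a summable centre DEFECT `μ_ν ≥ 1` (`IntervalWindowClause`, `TailDefectBound`), in `NearIso` currency at every consumer
(`InInterval.nearIso`, `inInterval_of_nearIso`).  Infrastructure for route-1's rung leaf F-D1.A0 (a frontier FORMAL rung); NOT a proof of the crux,
of Onsager's conjecture or of anomalous dissipation.  Landed by prover seat `ad-k3l-bookkeeping-p1` g3, 2026-08-28.
-/

set_option linter.dupNamespace false

namespace Summit.AnomalousDissipation.AnomalousDissipation.Theorems.SolenoidalFractalHomogenisation.LagrangianStep

open Literature.Analysis Literature.Analysis.FluidPDE Literature.Analysis.FunctionSpaces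
open MeasureTheory Set Filter
open scoped ENNReal NNReal InnerProductSpace

noncomputable section

/-! ## §1 The transverse Loewner order, order intervals, currency conversions -/

/-- Shapes = viscosity 4-tensors on `𝕋³`. -/
abbrev T4 : Type := Torus.Visc4 (Fin 3)

/-- TRANSVERSE LOEWNER (pre)ORDER: `S ≼ S'` iff `σ_S(k,p) ≤ σ_{S'}(k,p)` for all transverse pairs `p ⊥ k`. -/
def TransLE (S S' : T4) : Prop :=
  ∀ k p : Fin 3 → ℝ, ∑ i, p i * k i = 0 → Torus.symb S k p ≤ Torus.symb S' k p

/-- Transverse positivity `0 ≼ S`. -/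
def TransNonneg (S : T4) : Prop :=
  ∀ k p : Fin 3 → ℝ, ∑ i, p i * k i = 0 → 0 ≤ Torus.symb S k p

/-- The ORDER INTERVAL (closed part-metric ball of radius `log λ`) about `S⋆`: `S⋆/λ ≼ S ≼ λ S⋆`. -/
def InInterval (Sstar : T4) (lam : ℝ) (S : T4) : Prop :=
  TransLE ((1 / lam) • Sstar) S ∧ TransLE S (lam • Sstar)

/-- The transverse Loewner order is reflexive. [folklore] -/
theorem TransLE.refl (S : T4) : TransLE S S := fun _ _ _ => le_rfl

/-- The transverse Loewner order is transitive. [folklore] -/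
theorem TransLE.trans {A B C : T4} (h₁ : TransLE A B) (h₂ : TransLE B C) : TransLE A C :=
  fun k p hkp => (h₁ k p hkp).trans (h₂ k p hkp)

/-- The transverse Loewner order is preserved by nonnegative scaling. [folklore] -/
theorem TransLE.smul {A B : T4} (h : TransLE A B) {c : ℝ} (hc : 0 ≤ c) : TransLE (c • A) (c • B) := by
  intro k p hkp
  rw [Torus.symb_smul, Torus.symb_smul]
  exact mul_le_mul_of_nonneg_left (h k p hkp) hc

/-- The transverse Loewner order is preserved by sums. [folklore] -/
theorem TransLE.add {A B A' B' : T4} (h : TransLE A B) (h' : TransLE A' B') : TransLE (A + A') (B + B') := by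
  intro k p hkp
  rw [Torus.symb_add, Torus.symb_add]
  exact add_le_add (h k p hkp) (h' k p hkp)

/-- A tensor in a window `NearIso S lo hi` with `lo ≥ 0` is transversely nonnegative. [folklore] -/
theorem transNonneg_of_nearIso {S : T4} {lo hi : ℝ} (h : Torus.NearIso S lo hi) (hlo : 0 ≤ lo) : TransNonneg S :=
  fun k p hkp => le_trans (mul_nonneg hlo (by positivity)) (h k p hkp).1

/-- Transverse nonnegativity is preserved by nonnegative scaling. [folklore] -/
theorem TransNonneg.smul {S : T4} (h : TransNonneg S) {c : ℝ} (hc : 0 ≤ c) : TransNonneg (c • S) := by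
  intro k p hkp
  rw [Torus.symb_smul]
  exact mul_nonneg hc (h k p hkp)

/-- Transverse nonnegativity is preserved by sums. [folklore] -/
theorem TransNonneg.add {A B : T4} (hA : TransNonneg A) (hB : TransNonneg B) : TransNonneg (A + B) := by
  intro k p hkp
  rw [Torus.symb_add]
  exact add_nonneg (hA k p hkp) (hB k p hkp)

/-- Intervals grow with the aspect (`0 ≼ S⋆`). -/
theorem InInterval.mono {Sstar S : T4} {lam lam' : ℝ} (h : InInterval Sstar lam S) (hpos : TransNonneg Sstar)
    (hlam : 0 < lam) (hle : lam ≤ lam') : InInterval Sstar lam' S := by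
  constructor
  · intro k p hkp
    have h1 := h.1 k p hkp
    rw [Torus.symb_smul] at h1 ⊢
    calc (1 / lam') * Torus.symb Sstar k p ≤ (1 / lam) * Torus.symb Sstar k p :=
          mul_le_mul_of_nonneg_right (one_div_le_one_div_of_le hlam hle) (hpos k p hkp)
      _ ≤ Torus.symb S k p := h1
  · intro k p hkp
    have h2 := h.2 k p hkp
    rw [Torus.symb_smul] at h2 ⊢
    exact h2.trans (mul_le_mul_of_nonneg_right hle (hpos k p hkp))

/-- CONVERSION interval → band: `S ∈ [[S⋆/λ, λS⋆]]`, `NearIso S⋆ slo shi`, `λ ≥ 1` give `NearIso S (slo/λ) (shi·λ)`. -/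
theorem InInterval.nearIso {Sstar S : T4} {lam slo shi : ℝ} (hlam : 1 ≤ lam)
    (hstar : Torus.NearIso Sstar slo shi) (hS : InInterval Sstar lam S) :
    Torus.NearIso S (slo / lam) (shi * lam) := by
  have hlam0 : (0:ℝ) < lam := lt_of_lt_of_le one_pos hlam
  intro k p hkp
  obtain ⟨hl, hh⟩ := hstar k p hkp
  have h1 := hS.1 k p hkp
  have h2 := hS.2 k p hkp
  rw [Torus.symb_smul] at h1 h2
  have hQ : 0 ≤ (∑ a, k a ^ 2) * (∑ i, p i ^ 2) := by positivity
  constructor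
  · calc slo / lam * ((∑ a, k a ^ 2) * (∑ i, p i ^ 2)) = (1 / lam) * (slo * ((∑ a, k a ^ 2) * (∑ i, p i ^ 2))) := by ring
      _ ≤ (1 / lam) * Torus.symb Sstar k p := mul_le_mul_of_nonneg_left hl (by positivity)
      _ ≤ Torus.symb S k p := h1
  · calc Torus.symb S k p ≤ lam * Torus.symb Sstar k p := h2
      _ ≤ lam * (shi * ((∑ a, k a ^ 2) * (∑ i, p i ^ 2))) := mul_le_mul_of_nonneg_left hh (le_of_lt hlam0)
      _ = shi * lam * ((∑ a, k a ^ 2) * (∑ i, p i ^ 2)) := by ring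

/-- CONVERSION band → interval: `NearIso S a b` and `NearIso S⋆ slo shi` give `S ∈ [[S⋆/λ, λS⋆]]` as soon as `shi ≤ λ·a` and `b ≤ λ·slo`. -/
theorem inInterval_of_nearIso {Sstar S : T4} {slo shi a b lam : ℝ} (hstar : Torus.NearIso Sstar slo shi)
    (hS : Torus.NearIso S a b) (hlam : 0 < lam) (h1 : shi ≤ lam * a) (h2 : b ≤ lam * slo) :
    InInterval Sstar lam S := by
  have hne : lam ≠ 0 := hlam.ne'
  constructor
  · intro k p hkp
    rw [Torus.symb_smul]
    have hQ : 0 ≤ (∑ i, k i ^ 2) * (∑ i, p i ^ 2) := by positivity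
    obtain ⟨_, hh⟩ := hstar k p hkp
    obtain ⟨ha, _⟩ := hS k p hkp
    calc (1 / lam) * Torus.symb Sstar k p ≤ (1 / lam) * (shi * ((∑ i, k i ^ 2) * (∑ i, p i ^ 2))) :=
          mul_le_mul_of_nonneg_left hh (by positivity)
      _ ≤ (1 / lam) * (lam * a * ((∑ i, k i ^ 2) * (∑ i, p i ^ 2))) :=
          mul_le_mul_of_nonneg_left (mul_le_mul_of_nonneg_right h1 hQ) (by positivity)
      _ = a * ((∑ i, k i ^ 2) * (∑ i, p i ^ 2)) := by field_simp
      _ ≤ Torus.symb S k p := ha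
  · intro k p hkp
    rw [Torus.symb_smul]
    have hQ : 0 ≤ (∑ i, k i ^ 2) * (∑ i, p i ^ 2) := by positivity
    obtain ⟨hl, _⟩ := hstar k p hkp
    obtain ⟨_, hb⟩ := hS k p hkp
    calc Torus.symb S k p ≤ b * ((∑ i, k i ^ 2) * (∑ i, p i ^ 2)) := hb
      _ ≤ lam * slo * ((∑ i, k i ^ 2) * (∑ i, p i ^ 2)) := mul_le_mul_of_nonneg_right h2 hQ
      _ = lam * (slo * ((∑ i, k i ^ 2) * (∑ i, p i ^ 2))) := by ring
      _ ≤ lam * Torus.symb Sstar k p := mul_le_mul_of_nonneg_left hl hlam.le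

/-- `IntervalWindowClause Φν S⋆ slo shi λ₀ Λ β μ`: the centre `S⋆` has band `[slo, shi]`, the isotropic start `isoVisc 1` lies in `[[S⋆/λ₀, λ₀S⋆]]`
(`λ₀ ≥ 1`), and for every aspect `λ ∈ [λ₀, Λ]` the guarded interval `{OddSmall β} ∩ [[S⋆/λ, λS⋆]]` is mapped by `Φν` into `{OddSmall β} ∩
[[S⋆/(μλ), μλ S⋆]]`.  For the family: `∀ ν, IntervalWindowClause (Φ ν) S⋆ slo shi λ₀ Λ β (μ ν)` with a COMMON centre and summable defects. -/
def IntervalWindowClause (Φν : T4 → T4) (Sstar : T4) (slo shi lam₀ Λ β μ : ℝ) : Prop :=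
  Torus.NearIso Sstar slo shi ∧ 1 ≤ lam₀ ∧ InInterval Sstar lam₀ (Torus.isoVisc 1) ∧
  ∀ lam ∈ Set.Icc lam₀ Λ, ∀ S : T4, Torus.OddSmall S β → InInterval Sstar lam S →
    Torus.OddSmall (Φν S) β ∧ InInterval Sstar (μ * lam) (Φν S)

/-- The static conjuncts pin the window around `1`: `slo ≤ λ₀` and `1 ≤ λ₀·shi` (tested at the transverse pair `k = e₀`, `p = e₁`) — whence the
stub-text side conditions `lo ≤ 1 ≤ hi` for `lo ≤ slo/Λc`, `hi ≥ shi·Λc`, `Λc ≥ λ₀`. -/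
theorem window_straddles_one {Φν : T4 → T4} {Sstar : T4} {slo shi lam₀ Λ β μ : ℝ}
    (hwin : IntervalWindowClause Φν Sstar slo shi lam₀ Λ β μ) : slo ≤ lam₀ ∧ 1 ≤ lam₀ * shi := by
  obtain ⟨hstar, hlam₀, hiso, _⟩ := hwin
  have hlam0 : (0:ℝ) < lam₀ := by linarith
  set k : Fin 3 → ℝ := fun i => if i = 0 then 1 else 0 with hk
  set p : Fin 3 → ℝ := fun i => if i = 1 then 1 else 0 with hp
  have hkp : ∑ i, p i * k i = 0 := by simp [hk, hp]
  have hQ : (∑ a, k a ^ 2) * (∑ i, p i ^ 2) = 1 := by simp [hk, hp]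
  have hI : Torus.symb (Torus.isoVisc 1 : T4) k p = 1 := by
    obtain ⟨h₁, h₂⟩ := Torus.nearIso_isoVisc (d := Fin 3) 1 k p hkp
    rw [hQ] at h₁ h₂
    linarith
  obtain ⟨hl, hh⟩ := hstar k p hkp
  rw [hQ] at hl hh
  have h1 := hiso.1 k p hkp
  have h2 := hiso.2 k p hkp
  rw [Torus.symb_smul, hI] at h1 h2
  constructor
  · -- (1/λ₀)·slo ≤ (1/λ₀)·symb S⋆ ≤ 1
    have : (1 / lam₀) * slo ≤ 1 := le_trans (mul_le_mul_of_nonneg_left (by simpa using hl) (by positivity)) h1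
    rwa [div_mul_eq_mul_div, one_mul, div_le_one hlam0] at this
  · calc (1:ℝ) ≤ lam₀ * Torus.symb Sstar k p := h2
      _ ≤ lam₀ * shi := mul_le_mul_of_nonneg_left (by simpa using hh) hlam0.le

/-- [VERBATIM p1 r24 F1(a)] The shape chain driven by a LEVEL-DEPENDENT family of maps `Ψ i`. -/
def shapeSeqF (Ψ : ℕ → Torus.Visc4 (Fin 3) → Torus.Visc4 (Fin 3)) (g : ℕ → ℝ) (j : ℕ) : ℕ → Torus.Visc4 (Fin 3)
  | 0 => Torus.isoVisc 1
  | d + 1 => renormStep (Ψ (j - d)) (g (j - d)) (shapeSeqF Ψ g j d)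

/-- [VERBATIM p1 r24 F1(b)] The renormalised tensor chain of `E` for a ν-dependent shape map. -/
def chainTensorF {k : ℕ} (E : LatticeShear.LagrangianLatticeCarrier k) (Φ : ℝ → Torus.Visc4 (Fin 3) → Torus.Visc4 (Fin 3)) (j m : ℕ) :
    Torus.Visc4 (Fin 3) :=
  E.kbar m • shapeSeqF (fun i => Φ (E.cellVisc i)) (fun i => E.gain / E.cellVisc i ^ 2) j (j - m)

/-- For a constant family the family shape sequence is the landed `shapeSeq`. [folklore] -/
theorem shapeSeqF_const (Φ : Torus.Visc4 (Fin 3) → Torus.Visc4 (Fin 3)) (g : ℕ → ℝ) (j : ℕ) :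
    shapeSeqF (fun _ => Φ) g j = shapeSeq Φ g j := by
  funext d
  induction d with
  | zero => rfl
  | succ d ih => simp only [shapeSeqF, shapeSeq, ih]

/-- For a constant family the family chain tensor is the landed `chainTensor`. [folklore] -/
theorem chainTensorF_const {k : ℕ} (E : LatticeShear.LagrangianLatticeCarrier k) (Φ : Torus.Visc4 (Fin 3) → Torus.Visc4 (Fin 3)) (j m : ℕ) :
    chainTensorF E (fun _ => Φ) j m = chainTensor E Φ j m := by
  simp only [chainTensorF, chainTensor, shapeSeqF_const]

/-- The top tensor of the family chain is the isotropic `kbar_j`. -/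
theorem chainTensorF_top {k : ℕ} (E : LatticeShear.LagrangianLatticeCarrier k) (Φ : ℝ → Torus.Visc4 (Fin 3) → Torus.Visc4 (Fin 3)) (j : ℕ) :
    chainTensorF E Φ j j = Torus.isoVisc (E.kbar j) := by
  unfold chainTensorF
  rw [Nat.sub_self, shapeSeqF]
  funext i a j' b
  simp [Torus.isoVisc]

/-- Below the top, level `m` is the renormalisation of the level-`(m+1)` shape THROUGH `Φ (cellVisc (m+1))`. -/
theorem chainTensorF_succ {k : ℕ} (E : LatticeShear.LagrangianLatticeCarrier k) (Φ : ℝ → Torus.Visc4 (Fin 3) → Torus.Visc4 (Fin 3))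
    {j m : ℕ} (h : m < j) :
    chainTensorF E Φ j m = E.kbar m • renormStep (Φ (E.cellVisc (m + 1))) (E.gain / E.cellVisc (m + 1) ^ 2)
      (shapeSeqF (fun i => Φ (E.cellVisc i)) (fun i => E.gain / E.cellVisc i ^ 2) j (j - (m + 1))) := by
  unfold chainTensorF
  have h1 : j - m = (j - (m + 1)) + 1 := by omega
  have h2 : j - (j - (m + 1)) = m + 1 := by omega
  rw [h1]
  simp only [shapeSeqF, h2]

/-- The RUNNING ASPECT of the chain below top level `j`: `aspF μ λ₀ j d = λ₀ · ∏_{i<d} μ (j - i)` (one defect factor per level passed). -/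
def aspF (μ : ℕ → ℝ) (lam₀ : ℝ) (j : ℕ) : ℕ → ℝ
  | 0 => lam₀
  | d + 1 => μ (j - d) * aspF μ lam₀ j d

/-- The running aspect as a product: `aspF μ λ₀ j d = λ₀ · ∏_{i<d} μ(cellVisc (j − i))`. [folklore] -/
theorem aspF_eq_prod (μ : ℕ → ℝ) (lam₀ : ℝ) (j : ℕ) :
    ∀ d, aspF μ lam₀ j d = lam₀ * ∏ i ∈ Finset.range d, μ (j - i)
  | 0 => by simp [aspF]
  | d + 1 => by rw [aspF, aspF_eq_prod μ lam₀ j d, Finset.prod_range_succ]; ring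

/-- The running aspect never drops below `λ₀` (defects `μ ≥ 1`). [folklore] -/
theorem lam₀_le_aspF {μ : ℕ → ℝ} {lam₀ : ℝ} (hμ : ∀ i, 1 ≤ μ i) (h0 : 0 ≤ lam₀) (j : ℕ) :
    ∀ d, lam₀ ≤ aspF μ lam₀ j d
  | 0 => le_rfl
  | d + 1 => by
      have ih := lam₀_le_aspF hμ h0 j d
      have hnn : 0 ≤ aspF μ lam₀ j d := h0.trans ih
      calc lam₀ ≤ aspF μ lam₀ j d := ih
        _ ≤ μ (j - d) * aspF μ lam₀ j d := le_mul_of_one_le_left hnn (hμ _)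

/-- The running aspect is non-decreasing in the depth (defects `μ ≥ 1`). [folklore] -/
theorem aspF_le_succ {μ : ℕ → ℝ} {lam₀ : ℝ} (hμ : ∀ i, 1 ≤ μ i) (h0 : 0 ≤ lam₀) (j d : ℕ) :
    aspF μ lam₀ j d ≤ aspF μ lam₀ j (d + 1) :=
  le_mul_of_one_le_left (h0.trans (lam₀_le_aspF hμ h0 j d)) (hμ _)

/-- SUPPORT (S-sized; NOT proved here): along every permissible carrier on the template the running defect product is EVENTUALLY below the chain
budget `Λc`.  Follows from `∀ ν > 0, μ ν ≤ exp (D ν^σ)` (`D ≥ 0`, `σ > 0`) and `λ₀ < Λc`: `cellVisc (m+1) ≤ (N m/N (m+1))^{1/4} ≤ (N m)^{-1/4}`,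
`N 0 = 1`, `N (m+1) ≥ 2 N m`, so `∑_{i>m₁} cellVisc(i)^σ → 0`. -/
def TailDefectBound (μ : ℝ → ℝ) (lam₀ Λc : ℝ) : Prop :=
  ∀ k (E : LatticeShear.LagrangianLatticeCarrier k), E.LPermissible → (∀ m, E.N m ^ 2 ≤ E.N (m + 1)) →
    (∀ m, E.cellVisc (m + 1) * ((E.N (m + 1) : ℝ) / E.N m) ^ (1 / 4 : ℝ) ≤ 1) →
    ∃ m₁ : ℕ, ∀ j d : ℕ, m₁ + d ≤ j → aspF (fun i => μ (E.cellVisc i)) lam₀ j d ≤ Λc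

/-- With no centre defect the running aspect is constant. -/
theorem aspF_one (lam₀ : ℝ) (j : ℕ) : ∀ d, aspF (fun _ => (1:ℝ)) lam₀ j d = lam₀
  | 0 => rfl
  | d + 1 => by rw [aspF, aspF_one lam₀ j d, one_mul]

/-- The `μ ≡ 1` (I-centred / exact-interval) instantiation owes NOTHING for the tail bound: `TailDefectBound 1 λ₀ Λc` iff-trivially from `λ₀ ≤ Λc`. -/
theorem tailDefectBound_one {lam₀ Λc : ℝ} (h : lam₀ ≤ Λc) : TailDefectBound (fun _ => 1) lam₀ Λc :=
  fun _ _ _ _ _ => ⟨0, fun j d _ => (aspF_one lam₀ j d).le.trans h⟩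

/-- **THE INTERVAL WINDOW PACKAGE for the family** (what `stub_cellLawW_I` must output besides (V_ν)): the clause for every `ν` with a common centre,
defects `μ ≥ 1` with the tail bound, and the seven bookkeeping inequalities tying the clause's `(slo, shi, λ₀, Λ)` to the chain budget `Λc`, the
conversion aspect `Λ'` and the stub-text window `(lo, hi, ΛV)` of (V)/(T)/(L): `λ₀ ≤ Λc ≤ Λ`, `lo·Λc ≤ slo`, `shi·Λc ≤ hi` (chain side),
`Λ' ∈ [λ₀, Λ]`, `ΛV·shi ≤ Λ'·lo`, `ΛV·hi ≤ Λ'·slo` (F2 side). -/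
def IntervalWindowFamily (Φ : ℝ → T4 → T4) (μ : ℝ → ℝ) (Sstar : T4) (slo shi lam₀ Λ Λc Λ' β lo hi ΛV : ℝ) : Prop :=
  (∀ ν, IntervalWindowClause (Φ ν) Sstar slo shi lam₀ Λ β (μ ν)) ∧ (∀ ν, 1 ≤ μ ν) ∧ TailDefectBound μ lam₀ Λc ∧
  0 < slo ∧ lam₀ ≤ Λc ∧ Λc ≤ Λ ∧ lo * Λc ≤ slo ∧ shi * Λc ≤ hi ∧
  Λ' ∈ Set.Icc lam₀ Λ ∧ ΛV * shi ≤ Λ' * lo ∧ ΛV * hi ≤ Λ' * slo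

end

end Summit.AnomalousDissipation.AnomalousDissipation.Theorems.SolenoidalFractalHomogenisation.LagrangianStep
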